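import Literature.Analysis.FluidPDE.HydrodynamicImpulseBalance
import Literature.Analysis.FluidPDE.HydrodynamicImpulseBalanceEnergyVector
import Literature.Analysis.FluidPDE.NSVorticityHelicityProofs
import Literature.Analysis.FluidPDE.TotalVorticityFlux
import HarnessLib

/-!
# Hydrodynamic impulse, IV: the derivative form of Saffman's impulse law and the
# mean-zero-force rigidity of the rapidly decaying class

Sequel of `HydrodynamicImpulseBalance.lean` (Saffman, *Vortex Dynamics* (1992), §3.2 eq. (9):
`dI/dt = ∫ F dx`, `I = ½ ∫ x × ω dx`, typed there in INSTANTANEOUS form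
`∫ x × ∂ₜω(t) dx = 2 ∫ f(t) dx` (`IsClassicalNSSolutionOn.integral_cross_timeDerivWithin_vorticity`) and in
INTEGRATED form on `[t₁, t₂]` via Fubini). This file adds, for the tree's classical solutions
`IsClassicalNSSolutionOn S ν f u p` on `ℝ³ = EuclideanSpace ℝ (Fin 3)`:

* **the derivative form** `IsClassicalNSSolutionOn.hasDerivWithinAt_integral_cross_vorticity`: on a
  CONVEX time set `S`, `s ↦ ∫ x × ω(s, x) dx` has the one-sided derivative `2 ∫ f(t) dx` within `S` at
  every `t ∈ S` where the slice hypotheses of the instantaneous law hold, `x × ω(t) ∈ L¹`, and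
  `x × ∂ₜω` is dominated on `S` by an integrable function (differentiation under the integral sign,
  the tree's `hasDerivWithinAt_integral_of_dominated_convex`, then the instantaneous law); the
  domination is AUTOMATIC when the vorticity is uniformly rapidly decaying,
  `HasUniformRapidDecayOn S (vorticity u)` (`…_of_vorticityDecay`) — Saffman's standing hypothesis
  "the vorticity vanishes outside some finite region (or is exponentially small at infinity)" [§3.2,
  p. 50 and footnote 3], under which the VELOCITY is free to carry the `O(|I|/r³)` dipole tail of (3.2.7);
* **zero impulse of a Clay datum**: a `C¹` divergence-free field with Fefferman's decay (4)
  (`HasRapidSpatialDecay`) has `x × curl v ∈ L¹` and `∫ x × curl v dx = 0`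
  (`integral_cross_curl_eq_zero_of_hasRapidSpatialDecay`; the integrable case is
  `integral_cross_curl_eq_zero_of_isDivFree` of `HydrodynamicImpulseVector.lean`);
* **RIGIDITY** (`IsClassicalNSSolutionOn.integral_force_eq_zero_of_hasUniformRapidDecayOn`): if the
  VELOCITY is uniformly rapidly decaying on a convex `S` (the tree's Clay-type class
  `HasUniformRapidDecayOn S u`: all space–time derivatives bounded by `C_{n,K}(1 + |x|)^{-K}` uniformly
  on `S`), then `∫ x × ω(s) dx = 0` for all `s ∈ S`, while `d/dt ∫ x × ω = 2 ∫ f(t)` within `S`; by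
  uniqueness of the one-sided derivative, **`∫ f(t, x) dx = 0` at every non-isolated `t ∈ S` with
  `f(t) ∈ L¹`**. Contrapositive (`…not_hasUniformRapidDecayOn_of_integral_force_ne_zero`): a body force
  whose slice at one time has NON-ZERO spatial mean expels every classical solution it drives from the
  rapidly decaying class — Saffman's remark after (3.2.8), "the order of magnitude of the velocity field
  at infinity is `O(|I|/r³)`", as a theorem about the tree's classes. This is the Literature-side form
  of the reading recorded in `HydrodynamicImpulse.lean` ("the reason a forced Navier–Stokes slice need
  not be integrable");
* **RIGIDITY FROM THE ENERGY** (v2 append, section `RigidityEnergy`, after the energy-only vector law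
  `IsClassicalNSSolutionOn.integral_cross_vorticity_sub_eq_of_energy` of
  `HydrodynamicImpulseBalanceEnergyVector.lean`): on `[0, T] × ℝ³` with a uniform energy level and an
  integrable majorant of the force slices, TWO integrable velocity slices with integrable impulse
  densities force `∫ₛᵗ ∫ f dx dτ = 0`
  (`IsClassicalNSSolutionOn.intervalIntegral_integral_force_eq_zero_of_integrable`); such slices at every
  time force `∫ f(τ, x) dx = 0` at EVERY `τ ∈ [0, T]` (`…integral_force_eq_zero_of_forall_integrable`,
  `…_of_forall_hasRapidSpatialDecay`); and a Clay datum pushed by `∫₀ᵗ ∫ f ≠ 0` has at time `t` a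
  velocity slice outside `L¹(ℝ³)` whenever `x × ω(t) ∈ L¹` (`…not_integrable_slice_of_push_ne_zero`).

Everything is a consequence of `HydrodynamicImpulseBalance.lean` / `HydrodynamicImpulseVector.lean` /
`HydrodynamicImpulseBalanceEnergyVector.lean`, the exchange `∂ₜ curl = curl ∂ₜ`
(`IsSmoothSpaceTimeOn.curl_timeDerivWithin`) and the uniform-decay toolkit (`RapidDecayLemmas`,
`NSVorticityHelicityProofs`); no new definition, no named fact.

## References

* P. G. Saffman, *Vortex Dynamics*, Cambridge Univ. Press (1992), §3.2 eqs. (3.2.7)–(3.2.9),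
  (3.2.13), (3.2.15); §3.6 [cite: Saffman1992, §3.2 (3.2.7)–(3.2.9)].
* A. J. Majda, A. L. Bertozzi, *Vorticity and Incompressible Flow* (CUP 2002), §1.7 Prop. 1.12,
  eq. (1.68) [cite: MajdaBertozziCUP2002, §1.7 Prop. 1.12].
-/

noncomputable section

open MeasureTheory Filter Set Function Topology InnerProductSpace
open scoped RealInnerProductSpace Laplacian ContDiff

namespace Literature.Analysis.FluidPDE

/-! ### Pointwise helpers -/

/-- `‖a × b‖ ≤ ‖a‖ ‖b‖` (from the tree's `norm_cross`). [folklore] -/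
private theorem norm_cross_le_mul' (a b : EuclideanSpace ℝ (Fin 3)) : ‖cross a b‖ ≤ ‖a‖ * ‖b‖ := by
  rw [norm_cross]
  have h1 : Real.sin (InnerProductGeometry.angle a b) ≤ 1 := Real.sin_le_one _
  have h0 : 0 ≤ ‖a‖ * ‖b‖ := by positivity
  nlinarith

/-- Weight algebra: `‖x‖ (1 + ‖x‖)^{-(K+1)} ≤ (1 + ‖x‖)^{-K}`. [folklore] -/
private theorem norm_mul_rpow_neg_succ_le (x : EuclideanSpace ℝ (Fin 3)) (K : ℝ) :
    ‖x‖ * (1 + ‖x‖) ^ (-(K + 1)) ≤ (1 + ‖x‖) ^ (-K) := by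
  have h0 : 0 < 1 + ‖x‖ := by positivity
  have h1 : ‖x‖ ≤ 1 + ‖x‖ := by linarith [norm_nonneg x]
  calc ‖x‖ * (1 + ‖x‖) ^ (-(K + 1)) ≤ (1 + ‖x‖) * (1 + ‖x‖) ^ (-(K + 1)) := by gcongr
    _ = (1 + ‖x‖) ^ (1 : ℝ) * (1 + ‖x‖) ^ (-(K + 1)) := by rw [Real.rpow_one]
    _ = (1 + ‖x‖) ^ (-K) := by rw [← Real.rpow_add h0]; congr 1; ring

/-- `‖x × a‖ ≤ C (1 + ‖x‖)^{-K}` whenever `‖a‖ ≤ C (1 + ‖x‖)^{-(K+1)}`: one power of the weight absorbs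
the moment arm. [folklore] -/
private theorem norm_cross_le_of_le_rpow {x a : EuclideanSpace ℝ (Fin 3)} {C K : ℝ} (hC : 0 ≤ C)
    (ha : ‖a‖ ≤ C * (1 + ‖x‖) ^ (-(K + 1))) : ‖cross x a‖ ≤ C * (1 + ‖x‖) ^ (-K) :=
  calc ‖cross x a‖ ≤ ‖x‖ * ‖a‖ := norm_cross_le_mul' _ _
    _ ≤ ‖x‖ * (C * (1 + ‖x‖) ^ (-(K + 1))) := by gcongr
    _ = C * (‖x‖ * (1 + ‖x‖) ^ (-(K + 1))) := by ring
    _ ≤ C * (1 + ‖x‖) ^ (-K) := by gcongr; exact norm_mul_rpow_neg_succ_le x K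

/-- `x ↦ x × w(x)` is continuous for continuous `w`. [folklore] -/
private theorem continuous_cross_id {w : EuclideanSpace ℝ (Fin 3) → EuclideanSpace ℝ (Fin 3)}
    (hw : Continuous w) : Continuous fun x => cross x (w x) :=
  crossCLM.continuous₂.comp (continuous_id.prodMk hw)

/-- `dim ℝ³ < 4` in the form the weight lemmas want. [folklore] -/
private theorem finrank_lt_four : (Module.finrank ℝ (EuclideanSpace ℝ (Fin 3)) : ℝ) < (4 : ℝ) := by
  rw [finrank_euclideanSpace_fin]; norm_num

/-- `-(5 : ℕ) = -(4 + 1)` as real exponents. [folklore] -/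
private theorem neg_five_eq : (-((5 : ℕ) : ℝ)) = -((4 : ℝ) + 1) := by norm_num

/-! ### Zero impulse of a Clay datum (Fefferman's decay (4)) -/

section Datum

/-- The impulse density `x × curl v` of a `C¹` RAPIDLY DECAYING field (Fefferman's (4), the Clay datum
class `HasRapidSpatialDecay`) is integrable: `‖x × curl v(x)‖ ≤ ‖x‖ ‖curlCLM‖ ‖Dv(x)‖ ≤ C (1 + |x|)⁻⁴`,
so the impulse (3.2.8) of such a field is an absolutely convergent integral.
[cite: Saffman1992, §3.2 eq. (3.2.8)] -/
theorem integrable_cross_curl_of_hasRapidSpatialDecay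
    {v : EuclideanSpace ℝ (Fin 3) → EuclideanSpace ℝ (Fin 3)} (hv : ContDiff ℝ 1 v)
    (hd : HasRapidSpatialDecay v) : Integrable fun x => cross x (curl v x) := by
  obtain ⟨C, hC⟩ := hd 1 5
  have hC0 : 0 ≤ C := by
    have h2 : 0 ≤ (1 + ‖(0 : EuclideanSpace ℝ (Fin 3))‖) ^ 5 *
        ‖iteratedFDeriv ℝ 1 v 0‖ := by positivity
    linarith [hC 0]
  refine integrable_of_norm_le_rpow_neg (continuous_cross_id (continuous_curl hv))
    (C := ‖curlCLM‖ * C) finrank_lt_four fun x => ?_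
  have hD : ‖fderiv ℝ v x‖ ≤ C * (1 + ‖x‖) ^ (-((5 : ℕ) : ℝ)) := by
    have := le_mul_rpow_neg_of_pow_mul_le (hC x)
    rwa [norm_iteratedFDeriv_one] at this
  refine norm_cross_le_of_le_rpow (by positivity) ?_
  calc ‖curl v x‖ ≤ ‖curlCLM‖ * ‖fderiv ℝ v x‖ := norm_curl_le v x
    _ ≤ ‖curlCLM‖ * (C * (1 + ‖x‖) ^ (-((5 : ℕ) : ℝ))) := by gcongr
    _ = ‖curlCLM‖ * C * (1 + ‖x‖) ^ (-((4 : ℝ) + 1)) := by rw [neg_five_eq]; ring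

/-- **A Clay datum has zero impulse**: a `C¹` divergence-free rapidly decaying field
(`HasRapidSpatialDecay`, Fefferman's (4)) has `∫ x × curl v dx = 0` — every forced design's impulse
ledger opens at `I(0) = 0` (Saffman (3.2.13) + (3.2.15): the tree's
`integral_cross_curl_eq_zero_of_isDivFree` for integrable fields, with integrability supplied by the
decay). [cite: Saffman1992, §3.2 eqs. (3.2.8), (3.2.13), (3.2.15)] -/
theorem integral_cross_curl_eq_zero_of_hasRapidSpatialDecay
    {v : EuclideanSpace ℝ (Fin 3) → EuclideanSpace ℝ (Fin 3)} (hv : ContDiff ℝ 1 v)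
    (hdiv : VectorCalculus.IsDivFree v) (hd : HasRapidSpatialDecay v) :
    ∫ x, cross x (curl v x) = 0 :=
  integral_cross_curl_eq_zero_of_isDivFree hv hdiv (hd.integrable hv.continuous)
    (integrable_cross_curl_of_hasRapidSpatialDecay hv hd)

end Datum

/-! ### The derivative form `d/dt ∫ x × ω = 2 ∫ f` within a convex time set -/

section Derivative

variable {S : Set ℝ} {ν : ℝ}
  {f u : ℝ → EuclideanSpace ℝ (Fin 3) → EuclideanSpace ℝ (Fin 3)}
  {p : ℝ → EuclideanSpace ℝ (Fin 3) → ℝ}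

/-- **`d/dt ∫ x × ω dx = 2 ∫ f dx` (Saffman (3.2.9)) as a one-sided derivative within a convex time set.**
For a classical forced Navier–Stokes/Euler solution on `S × ℝ³`, `S` convex, and `t ∈ S` at which the slice
hypotheses of the instantaneous law (`IsClassicalNSSolutionOn.integral_cross_timeDerivWithin_vorticity`:
`‖u‖², ‖u‖‖Du‖, Δu, f(t) ∈ L¹`) hold, `x × ω(t) ∈ L¹`, and the impulse-rate density is DOMINATED on `S`
(`‖x × ∂ₜω(s, x)‖ ≤ bound(x)` for all `s ∈ S`, `bound ∈ L¹`), the function `s ↦ ∫ x × ω(s, x) dx` has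
derivative `2 ∫ f(t, x) dx` within `S` at `t` (differentiation under the integral sign,
`hasDerivWithinAt_integral_of_dominated_convex`, then the instantaneous law). At an isolated point of
`S` the statement is empty. [cite: Saffman1992, §3.2 eq. (3.2.9)] -/
theorem IsClassicalNSSolutionOn.hasDerivWithinAt_integral_cross_vorticity
    (h : IsClassicalNSSolutionOn S ν f u p) (hS : Convex ℝ S) {t : ℝ} (ht : t ∈ S)
    (h2 : Integrable fun x => ‖u t x‖ ^ 2)
    (hprod : Integrable fun x => ‖u t x‖ * ‖fderiv ℝ (u t) x‖)
    (hΔ : Integrable fun x => (Δ (u t)) x) (hf : Integrable (f t))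
    (hint : Integrable fun x => cross x (curl (u t) x))
    {bound : EuclideanSpace ℝ (Fin 3) → ℝ} (hbound : Integrable bound)
    (hdom : ∀ s ∈ S, ∀ x, ‖cross x (timeDerivWithin S (vorticity u) s x)‖ ≤ bound x) :
    HasDerivWithinAt (fun s => ∫ x, cross x (curl (u s) x)) ((2 : ℝ) • ∫ x, f t x) S t := by
  -- isolated points of `S`: the statement is empty
  by_cases hacc : AccPt t (𝓟 S)
  swap
  · exact hasDerivWithinAt_iff_hasFDerivWithinAt.2 (HasFDerivWithinAt.of_not_accPt hacc)
  have hU : UniqueDiffOn ℝ S := uniqueDiffOn_of_convex_of_accPt hS ht hacc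
  have hcl : S ⊆ closure (interior S) := subset_closure_interior_of_convex_of_accPt hS ht hacc
  have hsm := h.smooth_velocity
  have hv1 : ∀ s ∈ S, ContDiff ℝ 1 (u s) := fun s hs => (h.contDiff_velocity hs).of_le (by norm_cast)
  have hωst : IsSmoothSpaceTimeOn S (vorticity u) := (hsm.fderiv_slice hU).clm_comp curlCLM
  -- time derivative of the integrand
  have hdiff : ∀ s ∈ S, ∀ x, HasDerivWithinAt (fun s' => cross x (curl (u s') x))
      (cross x (timeDerivWithin S (vorticity u) s x)) S s := by
    intro s hs x
    have h1 := (crossCLM x).hasFDerivAt.comp_hasDerivWithinAt s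
      (hωst.hasDerivWithinAt_timeDerivWithin hU hs x)
    simpa [Function.comp_def, crossCLM_apply, vorticity_apply] using h1
  have hmeas : ∀ s ∈ S, AEStronglyMeasurable (fun x => cross x (curl (u s) x)) volume :=
    fun s hs => (continuous_cross_id (continuous_curl (hv1 s hs))).aestronglyMeasurable
  -- differentiate under the integral sign
  have hD := hasDerivWithinAt_integral_of_dominated_convex hS ht
    (F := fun s x => cross x (curl (u s) x))
    (F' := fun s x => cross x (timeDerivWithin S (vorticity u) s x)) (bound := bound)
    hmeas hint hdom hbound hdiff
  -- the derivative is `2 ∫ f` by the instantaneous law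
  have hIt : Integrable (fun x => cross x (timeDerivWithin S (vorticity u) t x)) :=
    Integrable.mono' hbound
      (continuous_cross_id (hωst.continuous_timeDerivWithin hU ht)).aestronglyMeasurable
      (Eventually.of_forall (hdom t ht))
  rwa [h.integral_cross_timeDerivWithin_vorticity hU hcl ht h2 hprod hΔ hf hIt] at hD

/-- **The derivative form under uniform rapid decay of the VORTICITY** (Saffman's standing hypothesis,
§3.2: "the vorticity vanishes outside some finite region … or is exponentially small at infinity"):
if `ω = vorticity u` satisfies `HasUniformRapidDecayOn S ω` on the convex time set `S` — the velocity may
carry the `O(|x|⁻³)` dipole tail — then at every `t ∈ S` where the slice hypotheses hold,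
`s ↦ ∫ x × ω(s) dx` has derivative `2 ∫ f(t) dx` within `S`; the domination of `x × ∂ₜω` by
`C (1 + |x|)⁻⁴ ∈ L¹(ℝ³)` and the integrability of `x × ω(t)` are automatic.
[cite: Saffman1992, §3.2 eq. (3.2.9)] -/
theorem IsClassicalNSSolutionOn.hasDerivWithinAt_integral_cross_vorticity_of_vorticityDecay
    (h : IsClassicalNSSolutionOn S ν f u p) (hS : Convex ℝ S)
    (hω : HasUniformRapidDecayOn S (vorticity u)) {t : ℝ} (ht : t ∈ S)
    (h2 : Integrable fun x => ‖u t x‖ ^ 2)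
    (hprod : Integrable fun x => ‖u t x‖ * ‖fderiv ℝ (u t) x‖)
    (hΔ : Integrable fun x => (Δ (u t)) x) (hf : Integrable (f t)) :
    HasDerivWithinAt (fun s => ∫ x, cross x (curl (u s) x)) ((2 : ℝ) • ∫ x, f t x) S t := by
  by_cases hacc : AccPt t (𝓟 S)
  swap
  · exact hasDerivWithinAt_iff_hasFDerivWithinAt.2 (HasFDerivWithinAt.of_not_accPt hacc)
  have hU : UniqueDiffOn ℝ S := uniqueDiffOn_of_convex_of_accPt hS ht hacc
  have hv1 : ContDiff ℝ 1 (u t) := (h.contDiff_velocity ht).of_le (by norm_cast)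
  have hωst : IsSmoothSpaceTimeOn S (vorticity u) :=
    (h.smooth_velocity.fderiv_slice hU).clm_comp curlCLM
  obtain ⟨A0, hA0, hA0b⟩ := hω.norm_le_rpow 5
  obtain ⟨A1, hA1, hA1b⟩ := hω.norm_timeDerivWithin_le_rpow hωst hU 5
  -- `x × ω(t) ∈ L¹`
  have hint : Integrable (fun x => cross x (curl (u t) x)) := by
    refine integrable_of_norm_le_rpow_neg (continuous_cross_id (continuous_curl hv1)) (C := A0)
      finrank_lt_four fun x => norm_cross_le_of_le_rpow hA0 ?_
    rw [← neg_five_eq, ← vorticity_apply]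
    exact hA0b t ht x
  -- domination of `x × ∂ₜω`
  have hbound : Integrable (fun x : EuclideanSpace ℝ (Fin 3) => A1 * (1 + ‖x‖) ^ (-(4 : ℝ))) :=
    (integrable_one_add_norm finrank_lt_four).const_mul A1
  have hdom : ∀ s ∈ S, ∀ x, ‖cross x (timeDerivWithin S (vorticity u) s x)‖ ≤
      A1 * (1 + ‖x‖) ^ (-(4 : ℝ)) := fun s hs x =>
    norm_cross_le_of_le_rpow hA1 (by rw [← neg_five_eq]; exact hA1b s hs x)
  exact h.hasDerivWithinAt_integral_cross_vorticity hS ht h2 hprod hΔ hf hint hbound hdom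

end Derivative

/-! ### Rigidity: a uniformly rapidly decaying velocity forces a mean-zero body force -/

section Rigidity

variable {S : Set ℝ} {ν : ℝ}
  {f u : ℝ → EuclideanSpace ℝ (Fin 3) → EuclideanSpace ℝ (Fin 3)}
  {p : ℝ → EuclideanSpace ℝ (Fin 3) → ℝ}

/-- A classical velocity with uniform rapid decay has ZERO impulse at every time of `S` (`S` of unique
differentiability): each slice is an integrable divergence-free `C¹` field with `x × ω ∈ L¹`, so
`∫ x × ω(s) dx = 0` (Saffman (3.2.13) + (3.2.15), the tree's `integral_cross_curl_eq_zero_of_isDivFree`).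
[cite: Saffman1992, §3.2 eqs. (3.2.8), (3.2.13), (3.2.15)] -/
theorem IsClassicalNSSolutionOn.integral_cross_vorticity_eq_zero_of_hasUniformRapidDecayOn
    (h : IsClassicalNSSolutionOn S ν f u p) (hU : UniqueDiffOn ℝ S)
    (hu : HasUniformRapidDecayOn S u) {s : ℝ} (hs : s ∈ S) :
    ∫ x, cross x (curl (u s) x) = 0 := by
  have hsm := h.smooth_velocity
  have hv1 : ContDiff ℝ 1 (u s) := (h.contDiff_velocity hs).of_le (by norm_cast)
  obtain ⟨A0, hA0, hA0b⟩ := hu.norm_le_rpow 4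
  obtain ⟨A1, hA1, hA1b⟩ := hu.norm_fderiv_le_rpow hsm hU 5
  have hint : Integrable (u s) :=
    integrable_of_norm_le_rpow_neg (hsm.continuous_slice hs) (C := A0) finrank_lt_four fun x =>
      (hA0b s hs x).trans_eq (by norm_num)
  have hI : Integrable (fun x => cross x (curl (u s) x)) := by
    refine integrable_of_norm_le_rpow_neg (continuous_cross_id (continuous_curl hv1))
      (C := ‖curlCLM‖ * A1) finrank_lt_four fun x => norm_cross_le_of_le_rpow (by positivity) ?_
    calc ‖curl (u s) x‖ ≤ ‖curlCLM‖ * ‖fderiv ℝ (u s) x‖ := norm_curl_le _ x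
      _ ≤ ‖curlCLM‖ * (A1 * (1 + ‖x‖) ^ (-((5 : ℕ) : ℝ))) := by gcongr; exact hA1b s hs x
      _ = ‖curlCLM‖ * A1 * (1 + ‖x‖) ^ (-((4 : ℝ) + 1)) := by rw [neg_five_eq]; ring
  exact integral_cross_curl_eq_zero_of_isDivFree hv1 (h.divFree s hs) hint hI

/-- **RIGIDITY: a classical solution whose VELOCITY is uniformly rapidly decaying has MEAN-ZERO FORCE.**
For a classical forced Navier–Stokes/Euler solution (any real `ν`) on a convex time set `S` with
`HasUniformRapidDecayOn S u` (the tree's Clay-type class: `(1 + |x|)^K ‖Dⁿ(uncurry u)(t, x)‖ ≤ C_{n,K}`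
on `S × ℝ³` for all `n, K`), at every non-isolated `t ∈ S` with `f(t) ∈ L¹`:
`∫ f(t, x) dx = 0`.
Proof: `∫ x × ω(s) dx = 0` for all `s ∈ S` (`integral_cross_vorticity_eq_zero_of_hasUniformRapidDecayOn`),
so this function has derivative `0` within `S` at `t`; it also has derivative `2 ∫ f(t)` there
(`hasDerivWithinAt_integral_cross_vorticity`, all slice hypotheses and the domination of
`x × ∂ₜω = x × curl ∂ₜu` following from the decay of `u`, `Du`, `D²u`, `D∂ₜu`); a convex set with an
accumulation point has unique one-sided derivatives. Contrapositively (Saffman, after (3.2.8): "the order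
of magnitude of the velocity field at infinity is `O(|I|/r³)`"), a push of non-zero spatial mean at one
instant is incompatible with a rapidly decaying velocity on any time interval through that instant.
[cite: Saffman1992, §3.2 eqs. (3.2.7)–(3.2.9)] -/
theorem IsClassicalNSSolutionOn.integral_force_eq_zero_of_hasUniformRapidDecayOn
    (h : IsClassicalNSSolutionOn S ν f u p) (hS : Convex ℝ S) (hu : HasUniformRapidDecayOn S u)
    {t : ℝ} (ht : t ∈ S) (hacc : AccPt t (𝓟 S)) (hf : Integrable (f t)) :
    ∫ x, f t x = 0 := by
  have hU : UniqueDiffOn ℝ S := uniqueDiffOn_of_convex_of_accPt hS ht hacc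
  have hcl : S ⊆ closure (interior S) := subset_closure_interior_of_convex_of_accPt hS ht hacc
  have hsm := h.smooth_velocity
  have hv1 : ∀ s ∈ S, ContDiff ℝ 1 (u s) := fun s hs => (h.contDiff_velocity hs).of_le (by norm_cast)
  have hv2 : ContDiff ℝ 2 (u t) := (h.contDiff_velocity ht).of_le (by norm_cast)
  have hr3 : (Module.finrank ℝ (EuclideanSpace ℝ (Fin 3)) : ℝ) < ((5 : ℕ) : ℝ) := by
    rw [finrank_euclideanSpace_fin]; norm_num
  have hK0 : (0 : ℝ) ≤ ((5 : ℕ) : ℝ) := by norm_num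
  -- uniform decay constants
  obtain ⟨A0, hA0, hA0b⟩ := hu.norm_le_rpow 5
  obtain ⟨A1, hA1, hA1b⟩ := hu.norm_fderiv_le_rpow hsm hU 5
  obtain ⟨A2, hA2, hA2b⟩ := hu.norm_fderiv_fderiv_le_rpow hsm hU 5
  obtain ⟨A4, hA4, hA4b⟩ := hu.norm_fderiv_timeDerivWithin_le_rpow hsm hU 5
  have hw1 (x : EuclideanSpace ℝ (Fin 3)) : (1 + ‖x‖) ^ (-((5 : ℕ) : ℝ)) ≤ (1 : ℝ) :=
    rpow_neg_le_one x hK0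
  -- continuity of the slices
  have hvc : Continuous (u t) := hsm.continuous_slice ht
  have hDvc : Continuous (fderiv ℝ (u t)) := hsm.continuous_fderiv_slice ht
  -- (1) `‖u‖² ∈ L¹`
  have h2 : Integrable (fun x => ‖u t x‖ ^ 2) := by
    refine integrable_of_norm_le_rpow_neg (hvc.norm.pow 2) (C := A0 * A0) hr3 fun x => ?_
    rw [Real.norm_of_nonneg (sq_nonneg _), sq]
    calc ‖u t x‖ * ‖u t x‖
        ≤ (A0 * (1 + ‖x‖) ^ (-((5 : ℕ) : ℝ))) * (A0 * (1 + ‖x‖) ^ (-((5 : ℕ) : ℝ))) :=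
          mul_le_mul (hA0b t ht x) (hA0b t ht x) (norm_nonneg _) (by positivity)
      _ ≤ (A0 * 1) * (A0 * (1 + ‖x‖) ^ (-((5 : ℕ) : ℝ))) := by gcongr; exact hw1 x
      _ = A0 * A0 * (1 + ‖x‖) ^ (-((5 : ℕ) : ℝ)) := by ring
  -- (2) `‖u‖ ‖Du‖ ∈ L¹`
  have hprod : Integrable (fun x => ‖u t x‖ * ‖fderiv ℝ (u t) x‖) := by
    refine integrable_of_norm_le_rpow_neg (hvc.norm.mul hDvc.norm) (C := A0 * A1) hr3 fun x => ?_
    rw [Real.norm_of_nonneg (by positivity)]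
    calc ‖u t x‖ * ‖fderiv ℝ (u t) x‖
        ≤ (A0 * (1 + ‖x‖) ^ (-((5 : ℕ) : ℝ))) * (A1 * (1 + ‖x‖) ^ (-((5 : ℕ) : ℝ))) :=
          mul_le_mul (hA0b t ht x) (hA1b t ht x) (norm_nonneg _) (by positivity)
      _ ≤ (A0 * 1) * (A1 * (1 + ‖x‖) ^ (-((5 : ℕ) : ℝ))) := by gcongr; exact hw1 x
      _ = A0 * A1 * (1 + ‖x‖) ^ (-((5 : ℕ) : ℝ)) := by ring
  -- (3) `Δu ∈ L¹`
  have hΔ : Integrable (fun x => (Δ (u t)) x) := by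
    refine integrable_of_norm_le_rpow_neg (continuous_laplacian hv2)
      (C := Module.finrank ℝ (EuclideanSpace ℝ (Fin 3)) * A2) hr3 fun x => ?_
    calc ‖(Δ (u t)) x‖
        ≤ Module.finrank ℝ (EuclideanSpace ℝ (Fin 3)) * ‖fderiv ℝ (fderiv ℝ (u t)) x‖ :=
          norm_laplacian_le (u t) x
      _ ≤ Module.finrank ℝ (EuclideanSpace ℝ (Fin 3)) * (A2 * (1 + ‖x‖) ^ (-((5 : ℕ) : ℝ))) := by
          gcongr; exact hA2b t ht x
      _ = Module.finrank ℝ (EuclideanSpace ℝ (Fin 3)) * A2 * (1 + ‖x‖) ^ (-((5 : ℕ) : ℝ)) := by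
          ring
  -- (4) `x × ω(t) ∈ L¹`
  have hint : Integrable (fun x => cross x (curl (u t) x)) := by
    refine integrable_of_norm_le_rpow_neg (continuous_cross_id (continuous_curl (hv1 t ht)))
      (C := ‖curlCLM‖ * A1) finrank_lt_four fun x => norm_cross_le_of_le_rpow (by positivity) ?_
    calc ‖curl (u t) x‖ ≤ ‖curlCLM‖ * ‖fderiv ℝ (u t) x‖ := norm_curl_le _ x
      _ ≤ ‖curlCLM‖ * (A1 * (1 + ‖x‖) ^ (-((5 : ℕ) : ℝ))) := by gcongr; exact hA1b t ht x
      _ = ‖curlCLM‖ * A1 * (1 + ‖x‖) ^ (-((4 : ℝ) + 1)) := by rw [neg_five_eq]; ring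
  -- (5) domination of `x × ∂ₜω = x × curl ∂ₜu`
  have hbound : Integrable (fun x : EuclideanSpace ℝ (Fin 3) =>
      ‖curlCLM‖ * A4 * (1 + ‖x‖) ^ (-(4 : ℝ))) :=
    (integrable_one_add_norm finrank_lt_four).const_mul (‖curlCLM‖ * A4)
  have hdom : ∀ s ∈ S, ∀ x, ‖cross x (timeDerivWithin S (vorticity u) s x)‖ ≤
      ‖curlCLM‖ * A4 * (1 + ‖x‖) ^ (-(4 : ℝ)) := by
    intro s hs x
    rw [← hsm.curl_timeDerivWithin hU hcl hs x]
    refine norm_cross_le_of_le_rpow (by positivity) ?_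
    calc ‖curl (timeDerivWithin S u s) x‖
        ≤ ‖curlCLM‖ * ‖fderiv ℝ (timeDerivWithin S u s) x‖ := norm_curl_le _ x
      _ ≤ ‖curlCLM‖ * (A4 * (1 + ‖x‖) ^ (-((5 : ℕ) : ℝ))) := by gcongr; exact hA4b s hs x
      _ = ‖curlCLM‖ * A4 * (1 + ‖x‖) ^ (-((4 : ℝ) + 1)) := by rw [neg_five_eq]; ring
  -- `∫ x × ω` has derivative `2 ∫ f t` within `S` at `t` …
  have hD := h.hasDerivWithinAt_integral_cross_vorticity hS ht h2 hprod hΔ hf hint hbound hdom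
  -- … and is identically zero on `S`
  have hzero : ∀ s ∈ S, ∫ x, cross x (curl (u s) x) = 0 := fun s hs =>
    h.integral_cross_vorticity_eq_zero_of_hasUniformRapidDecayOn hU hu hs
  have hD0 : HasDerivWithinAt (fun s => ∫ x, cross x (curl (u s) x)) 0 S t :=
    (hasDerivWithinAt_const t S (0 : EuclideanSpace ℝ (Fin 3))).congr_of_eventuallyEq
      (eventually_nhdsWithin_of_forall fun s hs => hzero s hs) (hzero t ht)
  have h20 : (2 : ℝ) • ∫ x, f t x = 0 := (hU t ht).eq_deriv S hD hD0
  exact (smul_eq_zero.1 h20).resolve_left (by norm_num)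

/-- **A push of non-zero spatial mean expels the solution from the rapidly decaying class**
(contrapositive of `integral_force_eq_zero_of_hasUniformRapidDecayOn`): if at some non-isolated `t` of
the convex time set `S` the force slice is integrable with `∫ f(t, x) dx ≠ 0`, then the velocity of NO
classical solution on `S` driven by `f` is uniformly rapidly decaying on `S` — its impulse must move, so
its far field is the `O(|I|/r³)` dipole (Saffman (3.2.7)). [cite: Saffman1992, §3.2 eqs. (3.2.7)–(3.2.9)] -/
theorem IsClassicalNSSolutionOn.not_hasUniformRapidDecayOn_of_integral_force_ne_zero
    (h : IsClassicalNSSolutionOn S ν f u p) (hS : Convex ℝ S) {t : ℝ} (ht : t ∈ S)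
    (hacc : AccPt t (𝓟 S)) (hf : Integrable (f t)) (hne : ∫ x, f t x ≠ 0) :
    ¬ HasUniformRapidDecayOn S u := fun hu =>
  hne (h.integral_force_eq_zero_of_hasUniformRapidDecayOn hS hu ht hacc hf)

/-- The interval form of the rigidity: on `[a, b]` with `a < b` EVERY time is non-isolated, so a
classical solution on `Icc a b × ℝ³` with uniformly rapidly decaying velocity has `∫ f(t) dx = 0` at
every `t ∈ [a, b]` with `f(t) ∈ L¹`. [cite: Saffman1992, §3.2 eqs. (3.2.7)–(3.2.9)] -/
theorem IsClassicalNSSolutionOn.integral_force_eq_zero_of_hasUniformRapidDecayOn_Icc {a b : ℝ}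
    (hab : a < b) (h : IsClassicalNSSolutionOn (Icc a b) ν f u p)
    (hu : HasUniformRapidDecayOn (Icc a b) u) {t : ℝ} (ht : t ∈ Icc a b)
    (hf : Integrable (f t)) : ∫ x, f t x = 0 := by
  refine h.integral_force_eq_zero_of_hasUniformRapidDecayOn (convex_Icc a b) hu ht ?_ hf
  -- every point of a nondegenerate closed interval is an accumulation point of it
  rw [accPt_iff_nhds]
  intro U hU
  rcases ht with ⟨hat, htb⟩
  obtain ⟨ε, hε, hball⟩ := Metric.mem_nhds_iff.1 hU
  by_cases htb' : t < b
  · -- move right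
    set s := min (t + ε / 2) ((t + b) / 2) with hs
    have hst : t < s := by
      rw [hs]; exact lt_min (by linarith) (by linarith)
    have hsb : s ≤ b := (min_le_right _ _).trans (by linarith)
    have hsε : s < t + ε := (min_le_left _ _).trans_lt (by linarith)
    refine ⟨s, ⟨hball ?_, ⟨by linarith, hsb⟩⟩, hst.ne'⟩
    rw [Metric.mem_ball, Real.dist_eq, abs_of_pos (by linarith)]
    linarith
  · -- `t = b`: move left
    have htb2 : t = b := le_antisymm htb (not_lt.1 htb')
    set s := max (t - ε / 2) ((a + t) / 2) with hs
    have hst : s < t := by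
      rw [hs]; exact max_lt (by linarith) (by linarith)
    have has : a ≤ s := le_trans (by linarith) (le_max_right _ _)
    have hsε : t - ε < s := lt_of_lt_of_le (by linarith) (le_max_left _ _)
    refine ⟨s, ⟨hball ?_, ⟨has, by linarith⟩⟩, hst.ne⟩
    rw [Metric.mem_ball, Real.dist_eq, abs_of_neg (by linarith)]
    linarith

end Rigidity

/-! ### Rigidity from the ENERGY (v2 append): two integrable slices pin the accumulated push

With the energy-only vector law of `HydrodynamicImpulseBalanceEnergyVector.lean`
(`IsClassicalNSSolutionOn.integral_cross_vorticity_sub_eq_of_energy`: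
`∫ x × ω(t) − ∫ x × ω(s) = 2 ∫ₛᵗ ∫ f` for every classical finite-energy forced flow on `[0, T] × ℝ³` whose
impulse densities at the two times `s ≤ t` are integrable — NO hypothesis on the vorticity in between,
only a uniform energy level and an integrable majorant of the force slices), the rigidity of the previous
section no longer needs the uniform Schwartz class `HasUniformRapidDecayOn S u`: an integrable
divergence-free `C¹` slice with integrable impulse density has zero impulse (Saffman (3.2.13) + (3.2.15)),
so TWO such slices force `∫ₛᵗ ∫ f dx dτ = 0`; slices of this kind at every time force `∫ f(τ, x) dx = 0`
at EVERY `τ ∈ [0, T]` (fundamental theorem of calculus within `[0, T]`); and — contrapositively, Saffman's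
remark after (3.2.8), "the order of magnitude of the velocity field at infinity is `O(|I|/r³)`" — a Clay
datum pushed by a force of non-zero accumulated mean `∫₀ᵗ ∫ f ≠ 0` has, at time `t`, a velocity slice
OUTSIDE `L¹(ℝ³)` as soon as its impulse density is integrable. The uniform-decay statements of the previous
section ask nothing of the force away from the instant `t` and nothing of the energy; the statements here
ask nothing of the flow strictly between the two slices beyond the energy level.
-/

section RigidityEnergy

variable {S : Set ℝ} {T ν : ℝ}
  {f u : ℝ → EuclideanSpace ℝ (Fin 3) → EuclideanSpace ℝ (Fin 3)}
  {p : ℝ → EuclideanSpace ℝ (Fin 3) → ℝ}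

/-- **An integrable slice with integrable impulse density has ZERO impulse** (any time set): for a
classical solution and `τ ∈ S` with `u(τ) ∈ L¹(ℝ³)` and `x × ω(τ) ∈ L¹`, `∫ x × ω(τ, x) dx = 0` — the slice
is `C¹` and divergence-free, so Saffman's (3.2.13) + (3.2.15) apply (the tree's
`integral_cross_curl_eq_zero_of_isDivFree`: `∫ x × curl v = 2 ∫ v = 0`).
[cite: Saffman1992, §3.2 eqs. (3.2.8), (3.2.13), (3.2.15)] -/
theorem IsClassicalNSSolutionOn.integral_cross_vorticity_eq_zero_of_integrable
    (h : IsClassicalNSSolutionOn S ν f u p) {τ : ℝ} (hτ : τ ∈ S) (hu : Integrable (u τ))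
    (hI : Integrable fun x => cross x (curl (u τ) x)) : ∫ x, cross x (curl (u τ) x) = 0 :=
  integral_cross_curl_eq_zero_of_isDivFree ((h.contDiff_velocity hτ).of_le (by norm_cast))
    (h.divFree τ hτ) hu hI

/-- **A slice in Fefferman's class has zero impulse** (any time set): if the velocity slice `u(τ)`,
`τ ∈ S`, has rapid spatial decay (`HasRapidSpatialDecay (u τ)`, Fefferman's (4) at that ONE time), then
`∫ x × ω(τ, x) dx = 0`. [cite: Saffman1992, §3.2 eqs. (3.2.8), (3.2.13), (3.2.15)] -/
theorem IsClassicalNSSolutionOn.integral_cross_vorticity_eq_zero_of_hasRapidSpatialDecay_slice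
    (h : IsClassicalNSSolutionOn S ν f u p) {τ : ℝ} (hτ : τ ∈ S) (hd : HasRapidSpatialDecay (u τ)) :
    ∫ x, cross x (curl (u τ) x) = 0 :=
  integral_cross_curl_eq_zero_of_hasRapidSpatialDecay ((h.contDiff_velocity hτ).of_le (by norm_cast))
    (h.divFree τ hτ) hd

/-- A continuous field in Fefferman's class is square-integrable (it is bounded and integrable).
[folklore] -/
private theorem integrable_norm_sq_of_hasRapidSpatialDecay
    {v : EuclideanSpace ℝ (Fin 3) → EuclideanSpace ℝ (Fin 3)} (hv : Continuous v)
    (hd : HasRapidSpatialDecay v) : Integrable fun x => ‖v x‖ ^ 2 := by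
  obtain ⟨C, hC⟩ := hd 0 0
  have hb : ∀ x, ‖v x‖ ≤ C := fun x => by simpa [norm_iteratedFDeriv_zero] using hC x
  refine ((hd.integrable hv).norm.const_mul C).mono' (hv.norm.pow 2).aestronglyMeasurable
    (Eventually.of_forall fun x => ?_)
  rw [Real.norm_of_nonneg (sq_nonneg _), sq]
  exact mul_le_mul_of_nonneg_right (hb x) (norm_nonneg _)

/-- **TWO INTEGRABLE SLICES PIN THE ACCUMULATED PUSH TO ZERO (rigidity from the energy).** Let `(u, p)`
be a classical solution of the Navier–Stokes system (any real `ν`) with force `f` on `[0, T] × ℝ³`, `0 < T`,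
with a uniform energy level `∫ ‖u(τ)‖² ≤ E` and an integrable majorant `F` of the force slices. If at two
times `0 ≤ s ≤ t ≤ T` the velocity slices are integrable with integrable impulse densities `x × ω(s)`,
`x × ω(t)`, then `∫ₛᵗ ∫ f(τ, x) dx dτ = 0`: both impulses vanish
(`integral_cross_vorticity_eq_zero_of_integrable`) while their difference is twice the accumulated push
(`integral_cross_vorticity_sub_eq_of_energy`). Nothing is assumed on the flow strictly between `s` and `t`
beyond the energy level. [cite: Saffman1992, §3.2 eqs. (3.2.8), (3.2.9)] -/
theorem IsClassicalNSSolutionOn.intervalIntegral_integral_force_eq_zero_of_integrable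
    (h : IsClassicalNSSolutionOn (Icc 0 T) ν f u p) (hT : 0 < T) {E : ℝ}
    (h2 : ∀ τ ∈ Icc 0 T, Integrable fun x => ‖u τ x‖ ^ 2) (hE : ∀ τ ∈ Icc 0 T, ∫ x, ‖u τ x‖ ^ 2 ≤ E)
    {F : EuclideanSpace ℝ (Fin 3) → ℝ} (hF : Integrable F) (hfF : ∀ τ ∈ Icc 0 T, ∀ x, ‖f τ x‖ ≤ F x)
    {s t : ℝ} (hs : 0 ≤ s) (hst : s ≤ t) (ht : t ≤ T)
    (hus : Integrable (u s)) (hIs : Integrable fun x => cross x (curl (u s) x))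
    (hut : Integrable (u t)) (hIt : Integrable fun x => cross x (curl (u t) x)) :
    ∫ τ in s..t, ∫ x, f τ x = 0 := by
  have hlaw := h.integral_cross_vorticity_sub_eq_of_energy hT h2 hE hF hfF hs hst ht hIs hIt
  rw [h.integral_cross_vorticity_eq_zero_of_integrable ⟨hs.trans hst, ht⟩ hut hIt,
    h.integral_cross_vorticity_eq_zero_of_integrable ⟨hs, hst.trans ht⟩ hus hIs, sub_zero] at hlaw
  exact (smul_eq_zero.1 hlaw.symm).resolve_left two_ne_zero

/-- The same with the two endpoint slices in Fefferman's class (`HasRapidSpatialDecay (u s)` and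
`HasRapidSpatialDecay (u t)` — rapid decay with all derivatives, at the two times only; integrability of
the slices and of their impulse densities is then automatic, `integrable_cross_curl_of_hasRapidSpatialDecay`):
`∫ₛᵗ ∫ f(τ, x) dx dτ = 0`. [cite: Saffman1992, §3.2 eqs. (3.2.8), (3.2.9)] -/
theorem IsClassicalNSSolutionOn.intervalIntegral_integral_force_eq_zero_of_hasRapidSpatialDecay
    (h : IsClassicalNSSolutionOn (Icc 0 T) ν f u p) (hT : 0 < T) {E : ℝ}
    (h2 : ∀ τ ∈ Icc 0 T, Integrable fun x => ‖u τ x‖ ^ 2) (hE : ∀ τ ∈ Icc 0 T, ∫ x, ‖u τ x‖ ^ 2 ≤ E)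
    {F : EuclideanSpace ℝ (Fin 3) → ℝ} (hF : Integrable F) (hfF : ∀ τ ∈ Icc 0 T, ∀ x, ‖f τ x‖ ≤ F x)
    {s t : ℝ} (hs : 0 ≤ s) (hst : s ≤ t) (ht : t ≤ T)
    (hds : HasRapidSpatialDecay (u s)) (hdt : HasRapidSpatialDecay (u t)) :
    ∫ τ in s..t, ∫ x, f τ x = 0 := by
  have h1s : ContDiff ℝ 1 (u s) := (h.contDiff_velocity (t := s) ⟨hs, hst.trans ht⟩).of_le (by norm_cast)
  have h1t : ContDiff ℝ 1 (u t) := (h.contDiff_velocity (t := t) ⟨hs.trans hst, ht⟩).of_le (by norm_cast)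
  exact h.intervalIntegral_integral_force_eq_zero_of_integrable hT h2 hE hF hfF hs hst ht
    (hds.integrable h1s.continuous) (integrable_cross_curl_of_hasRapidSpatialDecay h1s hds)
    (hdt.integrable h1t.continuous) (integrable_cross_curl_of_hasRapidSpatialDecay h1t hdt)

/-- **The impulse of a slice issued from a Clay datum IS the accumulated push.** Under the energy level and
the force majorant, if the initial slice `u(0)` is in Fefferman's class (`HasRapidSpatialDecay (u 0)`: a Clay
datum, zero initial impulse) and `x × ω(t) ∈ L¹` at some `t ∈ [0, T]`, then
`∫ x × ω(t, x) dx = 2 ∫₀ᵗ ∫ f(τ, x) dx dτ` (Saffman (3.2.9) integrated from the datum).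
[cite: Saffman1992, §3.2 eqs. (3.2.8), (3.2.9)] -/
theorem IsClassicalNSSolutionOn.integral_cross_vorticity_eq_two_smul_push
    (h : IsClassicalNSSolutionOn (Icc 0 T) ν f u p) (hT : 0 < T) {E : ℝ}
    (h2 : ∀ τ ∈ Icc 0 T, Integrable fun x => ‖u τ x‖ ^ 2) (hE : ∀ τ ∈ Icc 0 T, ∫ x, ‖u τ x‖ ^ 2 ≤ E)
    {F : EuclideanSpace ℝ (Fin 3) → ℝ} (hF : Integrable F) (hfF : ∀ τ ∈ Icc 0 T, ∀ x, ‖f τ x‖ ≤ F x)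
    (hd0 : HasRapidSpatialDecay (u 0)) {t : ℝ} (ht : t ∈ Icc 0 T)
    (hIt : Integrable fun x => cross x (curl (u t) x)) :
    ∫ x, cross x (curl (u t) x) = (2 : ℝ) • ∫ τ in (0 : ℝ)..t, ∫ x, f τ x := by
  have h0 : (0 : ℝ) ∈ Icc 0 T := ⟨le_rfl, hT.le⟩
  have h10 : ContDiff ℝ 1 (u 0) := (h.contDiff_velocity h0).of_le (by norm_cast)
  have hlaw := h.integral_cross_vorticity_sub_eq_of_energy hT h2 hE hF hfF le_rfl ht.1 ht.2
    (integrable_cross_curl_of_hasRapidSpatialDecay h10 hd0) hIt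
  rwa [h.integral_cross_vorticity_eq_zero_of_hasRapidSpatialDecay_slice h0 hd0, sub_zero] at hlaw

/-- **A PUSH OF NON-ZERO ACCUMULATED MEAN EXPELS THE SLICE FROM `L¹(ℝ³)`** (Saffman, after (3.2.8): "the
order of magnitude of the velocity field at infinity is `O(|I|/r³)`"). Let `(u, p)` be a classical
finite-energy solution on `[0, T] × ℝ³` (energy level, force majorant) issued from a Clay datum
(`HasRapidSpatialDecay (u 0)`). If at time `t ∈ [0, T]` the accumulated push `∫₀ᵗ ∫ f dx dτ` is NON-ZERO and
the impulse density `x × ω(t)` is integrable, then the velocity slice `u(t)` is NOT integrable on `ℝ³`: the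
slice carries the impulse `2 ∫₀ᵗ ∫ f ≠ 0` (`integral_cross_vorticity_eq_two_smul_push`), whereas an
integrable divergence-free slice with integrable impulse density has none.
[cite: Saffman1992, §3.2 eqs. (3.2.7)–(3.2.9)] -/
theorem IsClassicalNSSolutionOn.not_integrable_slice_of_push_ne_zero
    (h : IsClassicalNSSolutionOn (Icc 0 T) ν f u p) (hT : 0 < T) {E : ℝ}
    (h2 : ∀ τ ∈ Icc 0 T, Integrable fun x => ‖u τ x‖ ^ 2) (hE : ∀ τ ∈ Icc 0 T, ∫ x, ‖u τ x‖ ^ 2 ≤ E)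
    {F : EuclideanSpace ℝ (Fin 3) → ℝ} (hF : Integrable F) (hfF : ∀ τ ∈ Icc 0 T, ∀ x, ‖f τ x‖ ≤ F x)
    (hd0 : HasRapidSpatialDecay (u 0)) {t : ℝ} (ht : t ∈ Icc 0 T)
    (hpush : ∫ τ in (0 : ℝ)..t, ∫ x, f τ x ≠ 0) (hIt : Integrable fun x => cross x (curl (u t) x)) :
    ¬ Integrable (u t) := fun hut => by
  have hI := h.integral_cross_vorticity_eq_two_smul_push hT h2 hE hF hfF hd0 ht hIt
  rw [h.integral_cross_vorticity_eq_zero_of_integrable ht hut hIt] at hI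
  exact hpush ((smul_eq_zero.1 hI.symm).resolve_left two_ne_zero)

/-- A function continuous on `[0, T]`, `0 < T`, whose integrals `∫₀ᵗ` vanish for every `t ∈ [0, T]`, vanishes
on `[0, T]` (fundamental theorem of calculus within `[0, T]` and uniqueness of the one-sided derivative on an
interval). [folklore] -/
private theorem eq_zero_of_forall_intervalIntegral_eq_zero {g : ℝ → EuclideanSpace ℝ (Fin 3)}
    (hT : 0 < T) (hg : ContinuousOn g (Icc 0 T))
    (hint : ∀ t ∈ Icc 0 T, ∫ σ in (0 : ℝ)..t, g σ = 0) {τ : ℝ} (hτ : τ ∈ Icc 0 T) : g τ = 0 := by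
  haveI : Fact (τ ∈ Icc 0 T) := ⟨hτ⟩
  have hgi : IntervalIntegrable g volume 0 τ :=
    (hg.mono (Icc_subset_Icc_right hτ.2)).intervalIntegrable_of_Icc hτ.1
  have hD : HasDerivWithinAt (fun t => ∫ σ in (0 : ℝ)..t, g σ) (g τ) (Icc 0 T) τ :=
    intervalIntegral.integral_hasDerivWithinAt_right hgi
      (hg.stronglyMeasurableAtFilter_nhdsWithin measurableSet_Icc τ) (hg τ hτ)
  have hD0 : HasDerivWithinAt (fun t => ∫ σ in (0 : ℝ)..t, g σ) 0 (Icc 0 T) τ :=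
    (hasDerivWithinAt_const τ (Icc 0 T) (0 : EuclideanSpace ℝ (Fin 3))).congr_of_eventuallyEq
      (eventually_nhdsWithin_of_forall fun t ht => hint t ht) (hint τ hτ)
  exact (uniqueDiffOn_Icc hT τ hτ).eq_deriv _ hD hD0

/-- The spatial mean of the force, `τ ↦ ∫ f(τ, x) dx`, is continuous on `[0, T]` under an integrable majorant
of the force slices (the force of a classical solution is jointly continuous on the slab; dominated
convergence). [folklore] -/
private theorem IsClassicalNSSolutionOn.continuousOn_integral_force
    (h : IsClassicalNSSolutionOn (Icc 0 T) ν f u p) (hT : 0 < T)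
    {F : EuclideanSpace ℝ (Fin 3) → ℝ} (hF : Integrable F) (hfF : ∀ τ ∈ Icc 0 T, ∀ x, ‖f τ x‖ ≤ F x) :
    ContinuousOn (fun τ => ∫ x, f τ x) (Icc 0 T) := by
  have hfc : ContinuousOn (uncurry f) (Icc 0 T ×ˢ univ) :=
    (h.isSmoothSpaceTimeOn_force (uniqueDiffOn_Icc hT)).continuousOn
  refine continuousOn_of_dominated (bound := F) (fun τ hτ => ?_)
    (fun τ hτ => Eventually.of_forall (hfF τ hτ)) hF (Eventually.of_forall fun x => ?_)
  · have h1 : ContinuousOn (fun x : EuclideanSpace ℝ (Fin 3) => uncurry f (τ, x)) univ :=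
      hfc.comp (continuous_const.prodMk continuous_id).continuousOn
        fun x _ => mk_mem_prod hτ (mem_univ x)
    exact (continuousOn_univ.1 h1).aestronglyMeasurable
  · exact hfc.comp (continuous_id.prodMk continuous_const).continuousOn
      fun τ hτ => mk_mem_prod hτ (mem_univ x)

/-- **SLICES INTEGRABLE AT EVERY TIME ⇒ MEAN-ZERO FORCE AT EVERY TIME (rigidity from the energy).** Let
`(u, p)` be a classical finite-energy solution of the Navier–Stokes system (any real `ν`) with force `f` on
`[0, T] × ℝ³`, `0 < T` (energy level `E`, integrable force majorant `F`), whose velocity slice `u(τ)` and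
impulse density `x × ω(τ)` are integrable at EVERY `τ ∈ [0, T]`. Then `∫ f(τ, x) dx = 0` for every
`τ ∈ [0, T]`: the accumulated push `∫₀ᵗ ∫ f` vanishes identically on `[0, T]`
(`intervalIntegral_integral_force_eq_zero_of_integrable`) and its integrand is continuous there. Compare
`integral_force_eq_zero_of_hasUniformRapidDecayOn` (uniform Schwartz velocity on a convex time set, force
integrable at the one instant only): here only integrability of the slices is asked of the velocity, at the
price of the energy level and the force majorant on the slab. [cite: Saffman1992, §3.2 eqs. (3.2.7)–(3.2.9)] -/
theorem IsClassicalNSSolutionOn.integral_force_eq_zero_of_forall_integrable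
    (h : IsClassicalNSSolutionOn (Icc 0 T) ν f u p) (hT : 0 < T) {E : ℝ}
    (h2 : ∀ τ ∈ Icc 0 T, Integrable fun x => ‖u τ x‖ ^ 2) (hE : ∀ τ ∈ Icc 0 T, ∫ x, ‖u τ x‖ ^ 2 ≤ E)
    {F : EuclideanSpace ℝ (Fin 3) → ℝ} (hF : Integrable F) (hfF : ∀ τ ∈ Icc 0 T, ∀ x, ‖f τ x‖ ≤ F x)
    (hu : ∀ τ ∈ Icc 0 T, Integrable (u τ))
    (hI : ∀ τ ∈ Icc 0 T, Integrable fun x => cross x (curl (u τ) x)) {τ : ℝ} (hτ : τ ∈ Icc 0 T) :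
    ∫ x, f τ x = 0 :=
  have h0 : (0 : ℝ) ∈ Icc 0 T := ⟨le_rfl, hT.le⟩
  eq_zero_of_forall_intervalIntegral_eq_zero hT (h.continuousOn_integral_force hT hF hfF)
    (fun t ht => h.intervalIntegral_integral_force_eq_zero_of_integrable hT h2 hE hF hfF le_rfl ht.1
      ht.2 (hu 0 h0) (hI 0 h0) (hu t ht) (hI t ht)) hτ

/-- **FEFFERMAN'S CLASS AT EVERY TIME ⇒ MEAN-ZERO FORCE AT EVERY TIME.** If every velocity slice `u(τ)`,
`τ ∈ [0, T]`, of a classical solution on `[0, T] × ℝ³` (`0 < T`) has rapid spatial decay (Fefferman's (4),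
slice by slice — no uniformity of the constants in `τ`, nothing on time derivatives), the energy has a uniform
level `E` and the force slices an integrable majorant, then `∫ f(τ, x) dx = 0` at every `τ ∈ [0, T]`.
[cite: Saffman1992, §3.2 eqs. (3.2.7)–(3.2.9)] -/
theorem IsClassicalNSSolutionOn.integral_force_eq_zero_of_forall_hasRapidSpatialDecay
    (h : IsClassicalNSSolutionOn (Icc 0 T) ν f u p) (hT : 0 < T) {E : ℝ}
    (hE : ∀ τ ∈ Icc 0 T, ∫ x, ‖u τ x‖ ^ 2 ≤ E)
    {F : EuclideanSpace ℝ (Fin 3) → ℝ} (hF : Integrable F) (hfF : ∀ τ ∈ Icc 0 T, ∀ x, ‖f τ x‖ ≤ F x)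
    (hd : ∀ τ ∈ Icc 0 T, HasRapidSpatialDecay (u τ)) {τ : ℝ} (hτ : τ ∈ Icc 0 T) : ∫ x, f τ x = 0 :=
  have h1 : ∀ σ ∈ Icc 0 T, ContDiff ℝ 1 (u σ) := fun σ hσ =>
    (h.contDiff_velocity hσ).of_le (by norm_cast)
  h.integral_force_eq_zero_of_forall_integrable hT
    (fun σ hσ => integrable_norm_sq_of_hasRapidSpatialDecay (h1 σ hσ).continuous (hd σ hσ)) hE hF hfF
    (fun σ hσ => (hd σ hσ).integrable (h1 σ hσ).continuous)
    (fun σ hσ => integrable_cross_curl_of_hasRapidSpatialDecay (h1 σ hσ) (hd σ hσ)) hτ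

/-- **One instant of non-zero mean force ⇒ some slice leaves the integrable class** (contrapositive of
`integral_force_eq_zero_of_forall_integrable`): under the energy level and the force majorant, if
`∫ f(τ₀, x) dx ≠ 0` at one `τ₀ ∈ [0, T]`, then at some time `σ ∈ [0, T]` the velocity slice `u(σ)` or its
impulse density `x × ω(σ)` is not integrable on `ℝ³`. [cite: Saffman1992, §3.2 eqs. (3.2.7)–(3.2.9)] -/
theorem IsClassicalNSSolutionOn.exists_not_integrable_slice_of_integral_force_ne_zero
    (h : IsClassicalNSSolutionOn (Icc 0 T) ν f u p) (hT : 0 < T) {E : ℝ}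
    (h2 : ∀ τ ∈ Icc 0 T, Integrable fun x => ‖u τ x‖ ^ 2) (hE : ∀ τ ∈ Icc 0 T, ∫ x, ‖u τ x‖ ^ 2 ≤ E)
    {F : EuclideanSpace ℝ (Fin 3) → ℝ} (hF : Integrable F) (hfF : ∀ τ ∈ Icc 0 T, ∀ x, ‖f τ x‖ ≤ F x)
    {τ₀ : ℝ} (hτ₀ : τ₀ ∈ Icc 0 T) (hne : ∫ x, f τ₀ x ≠ 0) :
    ∃ σ ∈ Icc 0 T, ¬ Integrable (u σ) ∨ ¬ Integrable fun x => cross x (curl (u σ) x) := by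
  by_contra hall
  push Not at hall
  exact hne (h.integral_force_eq_zero_of_forall_integrable hT h2 hE hF hfF (fun σ hσ => (hall σ hσ).1)
    (fun σ hσ => (hall σ hσ).2) hτ₀)

/-- **One instant of non-zero mean force ⇒ NOT every slice is in Fefferman's class** (contrapositive of
`integral_force_eq_zero_of_forall_hasRapidSpatialDecay`; compare
`not_hasUniformRapidDecayOn_of_integral_force_ne_zero`, which excludes the UNIFORM Schwartz class without
energy or majorant hypotheses). [cite: Saffman1992, §3.2 eqs. (3.2.7)–(3.2.9)] -/
theorem IsClassicalNSSolutionOn.not_forall_hasRapidSpatialDecay_of_integral_force_ne_zero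
    (h : IsClassicalNSSolutionOn (Icc 0 T) ν f u p) (hT : 0 < T) {E : ℝ}
    (hE : ∀ τ ∈ Icc 0 T, ∫ x, ‖u τ x‖ ^ 2 ≤ E)
    {F : EuclideanSpace ℝ (Fin 3) → ℝ} (hF : Integrable F) (hfF : ∀ τ ∈ Icc 0 T, ∀ x, ‖f τ x‖ ≤ F x)
    {τ₀ : ℝ} (hτ₀ : τ₀ ∈ Icc 0 T) (hne : ∫ x, f τ₀ x ≠ 0) :
    ¬ ∀ σ ∈ Icc 0 T, HasRapidSpatialDecay (u σ) := fun hd =>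
  hne (h.integral_force_eq_zero_of_forall_hasRapidSpatialDecay hT hE hF hfF hd hτ₀)

end RigidityEnergy

end Literature.Analysis.FluidPDE

end
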